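import Summits.ResolutionOfSingularities.ResolutionOfSingularities.Theorems.MarkedTransferCampaignW46ThreefoldsSingular
import Literature.AlgebraicGeometry.Hironaka2017.PermissibleLSB
import Literature.AlgebraicGeometry.Resolution.BlowupDimension
import Literature.AlgebraicGeometry.Resolution.BlowupsProduct
import Literature.AlgebraicGeometry.Resolution.RegularCentreBlowupSeqIntegral
import Literature.AlgebraicGeometry.Resolution.NonPrincipalLocus
import Literature.AlgebraicGeometry.Resolution.AlterationsLemma32
import Literature.AlgebraicGeometry.Resolution.ProjectiveSpaceRegular
import Literature.AlgebraicGeometry.Resolution.SmoothOfRegularPerfectField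
import HarnessLib

/-!
# [OURS · L1 W4.6 rung (ii)] THREEFOLD HYPERSURFACES — the regime of stmt-16156 PROPAGATES along the typed
# procedure; rung (ii) in INITIAL-STATE form and in the words of the host item (proofs)

Cell res-hironaka, LADDER-RESOLUTION rung L (D-0089), slot W4.6, rung (ii); seat res-L1-s46-pv-3 (gen 2). Host route
MarkedTransfer, host item `HypersurfaceOrderReductionDimLeThree` (stmt-16156); `--kind proof --supports` it. Companion of
the statement module `MarkedTransferCampaignW46Threefolds` (v3) and of `…ThreefoldsReduction/Components/Singular`.

HONEST FRAMING. Everything below is OURS: kernel theorems over the campaign shapes (namespace `…Theorems.CampaignW46`)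
and the tree's blow-up library. NOTHING here is a statement of H. Hironaka's manuscript (2017-03-23, [Hironaka2017]) and
nothing asserts that any statement of it holds: the typed CANDIDATE carriers enter only through the shapes (`Resume`,
`Step`, `RunNabla`, …); the five structural shapes (`DecreaseII`, `EqualityII`, `StopsMonotoneII`, `NablaTopSingII`,
`OffCentreLocalII`) and the typed `Thm16_6` enter only as HYPOTHESES; the host item 16156 enters only through its
BINDERS — its conclusion (existence of a marked resolution) is never used. AI review is weaker than expert review.

## What this module adds (closing HONEST LIMIT 1 of the g0 summary «the reductions are regime-agnostic»)

1. REGIME PROPAGATION (the regime-(ii)-specific content). Along every step of the typed procedure admitted by the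
   literal centre rule (centre `D ⊆ ∇(E) ⊆ Sing(E)` smooth irreducible, `π` the blowing up along `𝓘_D`) the two binders
   of 16156 read on the state are INHERITED by the transform: `topologicalKrullDim Z′ ≤ 3` (Matsumura Thm. 15.5, tree
   `IsBlowup.topologicalKrullDim_le`) and `IsEffectiveCartier J′` (transform law `(𝓘_D𝒪_{Z′})^b · J′ = J𝒪_{Z′}` for a
   regular centre inside `Sing(E)`, tree `Hironaka2017.pow_mul_controlledTransform_eq_of_forall_le_idealOrder`, with
   `J𝒪_{Z′}` effective Cartier, Stacks 0809/07ZV, tree `IsEffectiveCartier.comap_of_isBlowup` / `.of_mul_right`);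
   standardness `J ≠ 0`, `b ≥ 1` is inherited too (`IsBlowup.comap_ne_bot`, Stacks 02OS). Hence `regimeII` at stage `0`
   of a run gives `regimeII` at every stage (`Run.regimeII_of_zero`).
2. INITIAL-STATE FORMS. The every-stage regime condition of the rung shapes collapses to a condition on the INPUT:
   `TerminatesNablaII N Rd ↔` no infinite ∇-centred run STARTS at a threefold-hypersurface state
   (`terminatesNablaII_iff_initial`) `↔ ∀ A₀ E₀, regimeII A₀ E₀ → ¬ DivergesFromNabla N Rd Regime.top A₀ E₀`
   (`terminatesNablaII_iff_forall_not_divergesFromNabla`); likewise for the whole-∇ and sub-centre shapes.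
3. THE HOST ITEM'S INPUTS ARE INITIAL STATES. The binders of 16156 — `k` perfect of characteristic `p`, `X` integral
   regular locally of finite type quasi-compact over `k`, `topologicalKrullDim X ≤ 3`, `I` effective Cartier, `m` — give
   an ambient datum `(X → Spec k)` (smooth by `smooth_of_isRegular_of_perfectField`, Matsumura §30) and a state
   `((X → Spec k), (I, m))` in `regimeII` (`regimeII_hostState`); `I ≠ 0`, `m ≥ 1` give standardness.
4. RUNG (ii) IN THE HOST'S WORDS. For the NAMED `N`, `Rd`: `TerminatesNablaII N Rd` — in particular the five shapes
   (`terminatesNablaII_of_decrease_sing`), or the typed `Thm16_6` AS A HYPOTHESIS with `StopsMonotoneII`,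
   `NablaTopSingII`, `OffCentreLocalII` — implies that for EVERY input `(k, X, I, m)` of 16156 the ∇-centred typed
   procedure admits no infinite run from the state `(X, (I, m))` (`not_divergesFromNabla_hostState[_of_shapes|_of_thm16_6]`).

Not claimed (honest limits): (a) 16156's CONCLUSION (`IsMarkedResolution`: snc with the accumulated boundary at every
centre, empty final support) is NOT derived — the typed Γ-free procedure records no boundary, so its termination is a
different theorem (calibration only); (b) the five shapes remain hypotheses about the named notion instance; (c) VACUITY
as (VAC) in the shared module.

References: statement module `…Threefolds.lean` v3 (p476988); reductions p472064, p475621, p475765, p477213; shared module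
`…TypedProcedure.lean` v3 (p468540) + anchors v2 (p468263); route MarkedTransfer item stmt-16156 (binders only)
[CossartJannsenSaito2020]; H. Matsumura, *Commutative Ring Theory*, Thm. 15.5, §30 [Matsumura1987]; Stacks Tags 0809,
07ZV, 02OS [StacksProject]; Cossart–Piltant, J. Algebra 320 (2008), proof of Prop. 4.2 [CossartPiltant2008] — all through
tree lemmas; H. Hironaka, ms. 2017-03-23, Th. 16.6 p.84, §16.3 p.87, Def. 2.1 p.5 — scope only, under adjudication, not
cited as fact. [Hironaka2017]
-/

noncomputable section

set_option linter.dupNamespace false -- mandated namespace of this single-conjunct summit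

open CategoryTheory AlgebraicGeometry TopologicalSpace

namespace Summit.ResolutionOfSingularities.ResolutionOfSingularities.Theorems

namespace CampaignW46

open Literature.AlgebraicGeometry.Resolution
open Literature.AlgebraicGeometry.Hironaka2017
open Literature.AlgebraicGeometry.Hironaka2017.S02Preliminaries
open Literature.AlgebraicGeometry.Hironaka2017.Datum
open Literature.AlgebraicGeometry.Hironaka2017.S15ARSchemes
open Literature.AlgebraicGeometry.Hironaka2017.S16Proof

universe u

variable {n : ℕ} {p : ℕ} [Fact p.Prime] {K : Type u} [Field K] [CharP K p]

/-! ## Standard facts about the ambient scheme of a state -/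

/-- The ambient scheme `Z` of an ambient datum (irreducible, smooth and quasi-compact over the field `K`) is locally
Noetherian, regular and integral (smooth over a field ⇒ locally of finite type ⇒ locally Noetherian; smooth over the
regular `Spec K` ⇒ regular, EGA IV 17.5.8; regular ⇒ reduced, + irreducible ⇒ integral). [folklore] -/
theorem ambientZ_std (A : AmbientDatum p K) :
    IsLocallyNoetherian A.Z ∧ Scheme.IsRegular A.Z ∧ IsIntegral A.Z := by
  haveI := A.smooth
  haveI := A.irreducible
  haveI hln : IsLocallyNoetherian A.Z := LocallyOfFiniteType.isLocallyNoetherian A.hom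
  have hreg : Scheme.IsRegular A.Z := Scheme.IsRegular.of_smooth A.hom (Scheme.isRegular_Spec (CommRingCat.of K))
  haveI : IsReduced A.Z := hreg.isReduced
  exact ⟨hln, hreg, isIntegral_of_irreducibleSpace_of_isReduced A.Z⟩

/-! ## Regime propagation along one step of the typed procedure -/

section Propagation

variable {N : Notions.{u} n} {A A' : AmbientDatum p K} {E : IdealExponent A.Z} {R : Resume N A E}

/-- The centre of a step admitted by the literal rule is a REGULAR scheme (its reduced structure `V(𝓘_D)` is smooth
over the field `K`, hence regular, EGA IV 17.5.8). [folklore] -/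
theorem IsCentre.isRegular_subscheme {D : Closeds A.Z} (h : IsCentre R D) :
    Scheme.IsRegular (Scheme.IdealSheafData.vanishingIdeal D).subscheme := by
  haveI := h.smooth
  exact Scheme.IsRegular.of_smooth ((Scheme.IdealSheafData.vanishingIdeal D).subschemeι ≫ A.hom)
    (Scheme.isRegular_Spec (CommRingCat.of K))

/-- The centre of a step lies in `Sing(E)`: `ord_y J ≥ b` at every `y ∈ D` (`D ⊆ ∇(E) ⊆ Sing(E)` by the résumé's
Def. 15.12 inclusion hypotheses). [folklore] -/
theorem Step.le_idealOrder_of_mem (s : Step R A') {y : A.Z} (hy : y ∈ (s.D : Set A.Z)) :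
    (E.b : ℕ∞) ≤ idealOrder E.J y :=
  s.centre.isPermissibleCentre.subset_sing hy

/-- **DIMENSION DOES NOT GO UP along a step** of the typed procedure: `topologicalKrullDim Z ≤ d ⇒
topologicalKrullDim Z′ ≤ d` for the blowing up `π : Z′ → Z` of the integral locally Noetherian `Z` along the centre
(Matsumura Thm. 15.5, tree `IsBlowup.topologicalKrullDim_le`). [cite: Matsumura1987, Thm. 15.5] -/
theorem Step.dimLE_transform (s : Step R A') {d : ℕ} (h : Regime.dimLE d A E) : Regime.dimLE d A' s.E' := by
  obtain ⟨hln, -, hint⟩ := ambientZ_std A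
  haveI := hln
  haveI := hint
  exact s.blowup.topologicalKrullDim_le h

/-- **THE TRANSFORM LAW OF Def. 2.1 FOR A STEP**: `(𝓘_D 𝒪_{Z′})^b · J′ = J 𝒪_{Z′}` for the transform `E′ = (J′, b)` of
`E = (J, b)` along a step of the typed procedure (regular centre inside `Sing(E)` of the regular locally Noetherian `Z`;
tree `Hironaka2017.pow_mul_controlledTransform_eq_of_forall_le_idealOrder`, Cossart–Piltant 2008, proof of Prop. 4.2).
[cite: CossartPiltant2008, proof of Prop. 4.2] -/
theorem Step.pow_mul_transformJ_eq (s : Step R A') :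
    (Scheme.IdealSheafData.vanishingIdeal s.D).comap s.π ^ E.b * s.E'.J = E.J.comap s.π := by
  obtain ⟨hln, hreg, -⟩ := ambientZ_std A
  obtain ⟨hln', -, -⟩ := ambientZ_std A'
  haveI := hln
  haveI := hln'
  exact pow_mul_controlledTransform_eq_of_forall_le_idealOrder hreg s.centre.isRegular_subscheme s.blowup
    (fun y hy => s.le_idealOrder_of_mem hy)

/-- **HYPERSURFACE EXPONENTS STAY HYPERSURFACE EXPONENTS along a step**: if `J` is effective Cartier then so is the
transform `J′` — `J𝒪_{Z′}` is effective Cartier (pull-back of an effective Cartier divisor along a blowing up, Stacks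
0809, tree `IsEffectiveCartier.comap_of_isBlowup`), it factors as `(𝓘_D𝒪_{Z′})^b · J′` (transform law), and a factor
of an effective Cartier ideal is effective Cartier (Stacks 07ZV, tree `IsEffectiveCartier.of_mul_right`).
[cite: StacksProject, Tags 0809 and 07ZV] -/
theorem Step.cartier_transform (s : Step R A') (h : Regime.cartier A E) : Regime.cartier A' s.E' := by
  have h1 : IsEffectiveCartier (E.J.comap s.π) := IsEffectiveCartier.comap_of_isBlowup s.blowup h
  rw [← s.pow_mul_transformJ_eq] at h1
  exact h1.of_mul_right

/-- **REGIME (ii) PROPAGATES**: a step of the typed procedure from a threefold-hypersurface state (`regimeII`: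
`topologicalKrullDim Z ≤ 3` and `J` effective Cartier — the binders of stmt-16156 on the state) lands in a
threefold-hypersurface state. [folklore] -/
theorem Step.regimeII_transform (s : Step R A') (h : regimeII A E) : regimeII A' s.E' :=
  ⟨s.dimLE_transform h.1, s.cartier_transform h.2⟩

/-- The centre of a step from a STANDARD state (`J ≠ 0`, `b ≥ 1`) is a proper closed subset of `Z`: the generic point
of the integral `Z` has `ord J = 0 < b`, so it is not in `Sing(E) ⊇ D`. [folklore] -/
theorem Step.support_vanishingIdeal_ne_top (s : Step R A') (h : E.IsStandard) :
    (Scheme.IdealSheafData.vanishingIdeal s.D).support ≠ ⊤ := by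
  obtain ⟨-, -, hint⟩ := ambientZ_std A
  haveI := hint
  intro htop
  have hgen : genericPoint A.Z ∈ (s.D : Set A.Z) := by
    rw [← Scheme.IdealSheafData.coe_support_vanishingIdeal s.D, htop]
    trivial
  have hsing : (E.b : ℕ∞) ≤ idealOrder E.J (genericPoint A.Z) := s.le_idealOrder_of_mem hgen
  have hb : (1 : ℕ∞) ≤ (E.b : ℕ∞) := by exact_mod_cast (h.2 : 1 ≤ E.b)
  exact not_mem_support_genericPoint h.1 ((one_le_idealOrder_iff E.J _).mp (hb.trans hsing))

/-- **STANDARDNESS PROPAGATES** (`J ≠ 0` and `b ≥ 1` are inherited by the transform): `J𝒪_{Z′} ≠ 0` because the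
blowing up of the integral `Z` along a proper closed centre is an isomorphism over a dense open (Stacks 02OS, tree
`IsBlowup.comap_ne_bot`), and `J𝒪_{Z′} ⊆ J′`; the exponent is unchanged. [cite: StacksProject, Tag 02OS] -/
theorem Step.isStandard_transform (s : Step R A') (h : E.IsStandard) : s.E'.IsStandard := by
  obtain ⟨-, -, hint⟩ := ambientZ_std A
  haveI := hint
  refine ⟨?_, h.2⟩
  have hne : E.J.comap s.π ≠ ⊥ := s.blowup.comap_ne_bot (s.support_vanishingIdeal_ne_top h) h.1
  intro hbot
  apply hne
  have hle : E.J.comap s.π ≤ s.E'.J :=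
    comap_le_controlledTransform s.π (Scheme.IdealSheafData.vanishingIdeal s.D) E.J E.b
  rw [hbot] at hle
  exact le_bot_iff.mp hle

end Propagation

/-! ## Regime propagation along runs; the INITIAL-STATE forms of the termination shapes -/

section Runs

variable {N : Notions.{u} n} {Rd : Reading p K N}

/-- Along a run of the typed procedure, regime (ii) at stage `0` gives regime (ii) at every stage. [folklore] -/
theorem Run.regimeII_of_zero (r : Run N Rd) (h : regimeII (r.A 0) (r.E 0)) : ∀ k, regimeII (r.A k) (r.E k) := by
  intro k
  induction k with
  | zero => exact h
  | succ k ih =>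
    rw [r.E_succ k]
    exact (r.step k).regimeII_transform ih

/-- Along a run, an ambient dimension bound at stage `0` holds at every stage. [folklore] -/
theorem Run.dimLE_of_zero (r : Run N Rd) {d : ℕ} (h : Regime.dimLE d (r.A 0) (r.E 0)) :
    ∀ k, Regime.dimLE d (r.A k) (r.E k) := by
  intro k
  induction k with
  | zero => exact h
  | succ k ih =>
    rw [r.E_succ k]
    exact (r.step k).dimLE_transform ih

/-- Along a run, a hypersurface exponent at stage `0` stays a hypersurface exponent at every stage. [folklore] -/
theorem Run.cartier_of_zero (r : Run N Rd) (h : Regime.cartier (r.A 0) (r.E 0)) :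
    ∀ k, Regime.cartier (r.A k) (r.E k) := by
  intro k
  induction k with
  | zero => exact h
  | succ k ih =>
    rw [r.E_succ k]
    exact (r.step k).cartier_transform ih

/-- Along a run, standardness at stage `0` gives standardness at every stage. [folklore] -/
theorem Run.isStandard_of_zero (r : Run N Rd) (h : (r.E 0).IsStandard) : ∀ k, (r.E k).IsStandard := by
  intro k
  induction k with
  | zero => exact h
  | succ k ih =>
    rw [r.E_succ k]
    exact (r.step k).isStandard_transform ih

/-- Along a ∇-centred run, regime (ii) at stage `0` gives regime (ii) at every stage. [folklore] -/
theorem RunNabla.regimeII_of_zero (r : RunNabla N Rd) (h : regimeII (r.A 0) (r.E 0)) :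
    ∀ k, regimeII (r.A k) (r.E k) :=
  r.toRun.regimeII_of_zero h

/-- **RUNG (ii), ∇-CENTRED, INITIAL-STATE FORM.** For the named `N`, `Rd`: `TerminatesNablaII N Rd` (no infinite
∇-centred run all of whose stages are threefold-hypersurface states) is EQUIVALENT to «no infinite ∇-centred run of the
typed procedure STARTS at a threefold-hypersurface state» — the regime is a condition on the input only, because it
propagates (`RunNabla.regimeII_of_zero`). [folklore] -/
theorem terminatesNablaII_iff_initial :
    TerminatesNablaII N Rd ↔ ∀ r : RunNabla N Rd, regimeII (r.A 0) (r.E 0) → False :=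
  ⟨fun h r h0 => h r (r.regimeII_of_zero h0), fun h r hr => h r (hr 0)⟩

/-- **RUNG (ii), WHOLE-∇, INITIAL-STATE FORM**: `TerminatesWholeII N Rd ↔` no infinite whole-∇ run starts at a
threefold-hypersurface state. [folklore] -/
theorem terminatesWholeII_iff_initial :
    TerminatesWholeII N Rd ↔ ∀ r : Run N Rd, r.IsWhole → regimeII (r.A 0) (r.E 0) → False :=
  ⟨fun h r hw h0 => h r hw (r.regimeII_of_zero h0), fun h r hw hr => h r hw (hr 0)⟩

/-- The sub-centre shape (ROLE WITHDRAWN in the shared module, kept for completeness), initial-state form: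
`Terminates N Rd regimeII ↔` no infinite sub-centre run starts at a threefold-hypersurface state. [folklore] -/
theorem terminates_regimeII_iff_initial :
    Terminates N Rd regimeII ↔ ∀ r : Run N Rd, regimeII (r.A 0) (r.E 0) → False :=
  ⟨fun h r h0 => h r (r.regimeII_of_zero h0), fun h r hr => h r (hr 0)⟩

/-- **NO ∇-DIVERGENCE AT ALL FROM A THREEFOLD-HYPERSURFACE STATE.** If `TerminatesNablaII N Rd`, then from every state
`(A₀, E₀)` in regime (ii) the ∇-centred typed procedure admits no infinite run — in ANY regime `Rg`, in particular
`Regime.top` (no condition on the later stages): `¬ DivergesFromNabla N Rd Rg A₀ E₀`. [folklore] -/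
theorem not_divergesFromNabla_of_regimeII (h : TerminatesNablaII N Rd) {A₀ : AmbientDatum p K}
    {E₀ : IdealExponent A₀.Z} (h₀ : regimeII A₀ E₀) (Rg : Regime p K) : ¬ DivergesFromNabla N Rd Rg A₀ E₀ := by
  rintro ⟨r, -⟩
  refine h r.toRunNabla (r.toRunNabla.regimeII_of_zero ?_)
  change regimeII A₀ (r.E 0)
  rw [r.E_zero]
  exact h₀

/-- Pure logic: a ∇-centred run all of whose stages lie in `Rg` is a divergent ∇-centred run FROM its own stage `0`
(the `RunFromNabla` bookkeeping of the shared module: stage `0` pinned definitionally). [folklore] -/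
theorem RunNabla.divergesFromNabla_zero (r : RunNabla N Rd) {Rg : Regime p K} (hr : ∀ k, Rg (r.A k) (r.E k)) :
    DivergesFromNabla N Rd Rg (r.A 0) (r.E 0) := by
  refine ⟨⟨fun k => r.A (k + 1), fun k => ?_, ?_, ?_, ?_, ?_, ?_⟩, ?_⟩
  · exact match k with
      | 0 => r.E 0
      | k + 1 => r.E (k + 1)
  · rfl
  · exact fun k => match k with
      | 0 => r.R 0
      | k + 1 => r.R (k + 1)
  · exact fun k => match k with
      | 0 => r.reads 0
      | k + 1 => r.reads (k + 1)
  · exact fun k => match k with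
      | 0 => r.step 0
      | k + 1 => r.step (k + 1)
  · intro k
    match k with
    | 0 => exact r.E_succ 0
    | k + 1 => exact r.E_succ (k + 1)
  · intro k
    match k with
    | 0 => exact hr 0
    | k + 1 => exact hr (k + 1)

/-- Pure logic: ∇-divergence somewhere in a regime is ∇-divergence from some state of it. [folklore] -/
theorem divergesNabla_iff_exists_divergesFromNabla {Rg : Regime p K} :
    DivergesNabla N Rd Rg ↔
      ∃ (A₀ : AmbientDatum p K) (E₀ : IdealExponent A₀.Z), DivergesFromNabla N Rd Rg A₀ E₀ := by
  constructor
  · rintro ⟨r, hr⟩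
    exact ⟨r.A 0, r.E 0, r.divergesFromNabla_zero hr⟩
  · rintro ⟨A₀, E₀, r, hr⟩
    exact ⟨r.toRunNabla, hr⟩

/-- **RUNG (ii), ∇-CENTRED, FROM-A-STATE FORM**: `TerminatesNablaII N Rd ↔ ∀ A₀ E₀, regimeII A₀ E₀ →
¬ DivergesFromNabla N Rd Regime.top A₀ E₀` — «the ∇-centred typed procedure, started on a hypersurface exponent in an
ambient scheme of Krull dimension `≤ 3`, never runs for ever», with no condition on the later stages. [folklore] -/
theorem terminatesNablaII_iff_forall_not_divergesFromNabla :
    TerminatesNablaII N Rd ↔ ∀ (A₀ : AmbientDatum p K) (E₀ : IdealExponent A₀.Z), regimeII A₀ E₀ →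
      ¬ DivergesFromNabla N Rd Regime.top A₀ E₀ := by
  constructor
  · exact fun h A₀ E₀ h₀ => not_divergesFromNabla_of_regimeII h h₀ Regime.top
  · intro h
    rw [terminatesNablaII_iff_initial]
    exact fun r h0 => h (r.A 0) (r.E 0) h0 (r.divergesFromNabla_zero fun _ => trivial)

end Runs

/-! ## The host item's inputs are initial states of the typed procedure in regime (ii) -/

section Host

variable {k : Type u} [Field k] [CharP k p]

/-- **THE BINDERS OF stmt-16156 GIVE A THREEFOLD-HYPERSURFACE STATE.** For a perfect field `k` of characteristic `p`, an
integral regular scheme `X` locally of finite type and quasi-compact over `k` with `topologicalKrullDim X ≤ 3`, an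
effective Cartier ideal `I` and any `m`: the pair `(X → Spec k)` is an ambient datum of the typed procedure (irreducible;
SMOOTH over `k` because regular of finite type over a perfect field, Matsumura §30, tree
`smooth_of_isRegular_of_perfectField`; quasi-compact) and the state `((X → Spec k), (I, m))` lies in `regimeII`. The
separatedness binder of 16156 is not needed; `I ≠ 0`, `m ≥ 1` give standardness (`isStandard_hostState`). The
CONCLUSION of 16156 is not used. [cite: Matsumura1987, §30] -/
theorem regimeII_hostState [PerfectField k] (X : Scheme.{u}) (s : X ⟶ Spec (.of k)) [LocallyOfFiniteType s]
    [QuasiCompact s] [IsIntegral X] (hreg : Scheme.IsRegular X) (hdim : topologicalKrullDim X ≤ 3)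
    (I : X.IdealSheafData) (hIc : IsEffectiveCartier I) (m : ℕ) :
    regimeII (⟨X, s, inferInstance, smooth_of_isRegular_of_perfectField s hreg, inferInstance⟩ : AmbientDatum p k)
      ⟨I, m⟩ :=
  ⟨by simpa [Regime.dimLE] using hdim, hIc⟩

/-- The remaining binders `I ≠ 0`, `1 ≤ m` of stmt-16156 say that the initial ideal exponent `(I, m)` is standard.
[folklore] -/
theorem isStandard_hostState (X : Scheme.{u}) (I : X.IdealSheafData) (hI : I ≠ ⊥) (m : ℕ) (hm : 1 ≤ m) :
    IdealExponent.IsStandard (Z := X) ⟨I, m⟩ :=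
  ⟨hI, hm⟩

variable {N : Notions.{u} n} {Rd : Reading p k N}

/-- **RUNG (ii) IN THE WORDS OF THE HOST ITEM.** For the NAMED notion instance `N` and reading `Rd`: if
`TerminatesNablaII N Rd`, then for EVERY input of `HypersurfaceOrderReductionDimLeThree` (stmt-16156) — `k` perfect of
characteristic `p`, `X` integral regular locally of finite type quasi-compact over `k` of Krull dimension `≤ 3`, `I`
effective Cartier, `m` — the ∇-centred typed Th. 16.6 procedure admits NO infinite run from the state `(X, (I, m))`
(in any regime `Rg`, e.g. `Regime.top`). 16156's conclusion is not used and not derived. [folklore] -/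
theorem not_divergesFromNabla_hostState [PerfectField k] (h : TerminatesNablaII N Rd) (X : Scheme.{u})
    (s : X ⟶ Spec (.of k)) [LocallyOfFiniteType s] [QuasiCompact s] [IsIntegral X] (hreg : Scheme.IsRegular X)
    (hdim : topologicalKrullDim X ≤ 3) (I : X.IdealSheafData) (hIc : IsEffectiveCartier I) (m : ℕ) (Rg : Regime p k) :
    ¬ DivergesFromNabla N Rd Rg
        (⟨X, s, inferInstance, smooth_of_isRegular_of_perfectField s hreg, inferInstance⟩ : AmbientDatum p k) ⟨I, m⟩ :=
  not_divergesFromNabla_of_regimeII h (regimeII_hostState X s hreg hdim I hIc m) Rg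

/-- **RUNG (ii) IN THE WORDS OF THE HOST ITEM, FROM THE FIVE SHAPES** (the component-wise reduction of
`…ThreefoldsSingular`, `terminatesNablaII_of_decrease_sing`): `DecreaseII ∧ EqualityII ∧ StopsMonotoneII ∧ NablaTopSingII
∧ OffCentreLocalII` for the named `N`, `Rd` imply that from every input `(k, X, I, m)` of stmt-16156 the ∇-centred typed
procedure admits no infinite run. All five shapes are HYPOTHESES; nothing of the manuscript is asserted. [folklore] -/
theorem not_divergesFromNabla_hostState_of_shapes [PerfectField k] (hD : DecreaseII N Rd) (hEq : EqualityII N Rd)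
    (hM : StopsMonotoneII N Rd) (hT : NablaTopSingII N Rd) (hL : OffCentreLocalII N Rd) (X : Scheme.{u})
    (s : X ⟶ Spec (.of k)) [LocallyOfFiniteType s] [QuasiCompact s] [IsIntegral X] (hreg : Scheme.IsRegular X)
    (hdim : topologicalKrullDim X ≤ 3) (I : X.IdealSheafData) (hIc : IsEffectiveCartier I) (m : ℕ) (Rg : Regime p k) :
    ¬ DivergesFromNabla N Rd Rg
        (⟨X, s, inferInstance, smooth_of_isRegular_of_perfectField s hreg, inferInstance⟩ : AmbientDatum p k) ⟨I, m⟩ :=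
  not_divergesFromNabla_hostState (terminatesNablaII_of_decrease_sing N Rd hD hEq hM hT hL) X s hreg hdim I hIc m Rg

/-- **RUNG (ii) IN THE WORDS OF THE HOST ITEM, WITH THE TYPED CANDIDATE AS A HYPOTHESIS**: the typed `S16Proof.Thm16_6`
(reading R, any part-(4) parameter — consumed only as a hypothesis) together with `StopsMonotoneII`, `NablaTopSingII`,
`OffCentreLocalII` for the named `N`, `Rd` imply that from every input `(k, X, I, m)` of stmt-16156 the ∇-centred typed
procedure admits no infinite run. Nothing of the manuscript is asserted. [folklore] -/
theorem not_divergesFromNabla_hostState_of_thm16_6 [PerfectField k]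
    {pPosiEmptyAt : ∀ {W : Scheme.{u}}, IdealExponent W → W → Prop}
    (h16 : Thm16_6 (p := p) (K := k) n (primeR N Rd) pPosiEmptyAt) (hM : StopsMonotoneII N Rd)
    (hT : NablaTopSingII N Rd) (hL : OffCentreLocalII N Rd) (X : Scheme.{u}) (s : X ⟶ Spec (.of k))
    [LocallyOfFiniteType s] [QuasiCompact s] [IsIntegral X] (hreg : Scheme.IsRegular X)
    (hdim : topologicalKrullDim X ≤ 3) (I : X.IdealSheafData) (hIc : IsEffectiveCartier I) (m : ℕ) (Rg : Regime p k) :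
    ¬ DivergesFromNabla N Rd Rg
        (⟨X, s, inferInstance, smooth_of_isRegular_of_perfectField s hreg, inferInstance⟩ : AmbientDatum p k) ⟨I, m⟩ :=
  not_divergesFromNabla_hostState (terminatesNablaII_of_thm16_6_sing N Rd h16 hM hT hL) X s hreg hdim I hIc m Rg

end Host

end CampaignW46

end Summit.ResolutionOfSingularities.ResolutionOfSingularities.Theorems

end
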